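import Mathlib
import HarnessLib
import Summits.ValiantsHypothesis.ValiantsHypothesis.Theorems.MonotoneRestorationMonotoneRestorationQPLinearWidthCFIHomMonotoneApex
import Summits.ValiantsHypothesis.ValiantsHypothesis.Theorems.MonotoneRestorationMonotoneRestorationQPLinearWidthCFIHomMonotoneLinearWitnessRung

/-!
# Route MonotoneRestoration, crux `MonotoneRestorationQP` (stmt-15886), line `linear_width` —
# CAPSTONE OF THE ABSORBING-CFI ROUTE: the `√N` rung from ONE graph-theoretic input (induced wide 2-subdivisions)

Helper file (`--supports stmt-ValiantsHypothesis-15886`), def-free.  Assembles the g13 chain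
(`CFIHomMonotone` p841399 → `…Apex` p841446/p841497 → `…LinearWitnessRung` p841464/p841477) into one statement whose only
hypothesis is graph-theoretic and local to the PATTERN:

  (IND₂)_{C,g} : every isolated-vertex-free bipartite pattern `E ⊆ Fin a × Fin b` with `tw(patternGraph E) ≥ g k` contains an
                 INDUCED copy of the 2-subdivision `subdiv B` of some connected base `B` on `Fin v` (`v ≥ 2`, an edge,
                 `tw B ≥ k`) with `|CFI(B)| + 2 ≤ C · (a + b + 1)`.

* `linearWitness_of_inducedSubdivisions` — (IND₂)_{C,g} ⇒ (W1-lin)_{C,g} at every width `k ≥ 1` (apex witnesses, unconditional);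
* `widthRung_sqrt_of_inducedSubdivisions` — **(IND₂)_{C,g} with `g k ≤ (k+2)^e` ⇒ `WidthRung (fun n => Nat.sqrt n / (3C+3))`**.

Status of (IND₂) (honest label): for patterns of maximum degree `≤ Δ` it follows from Korhonen's induced-wall theorem (JCTB 160,
2023; to be typed BY NAME, growth of its bound to be checked) plus a mod-3 normalisation of an induced subdivided wall into an
induced `subdiv B` with `B` subcubic (then `|CFI(B)| ≤ 14|B|`, `CFIHomMonotone.card_cfiVertex_le`; `tw` bounds via
`le_treewidth_wall`, `treewidth_le_of_isTopologicalMinor`) — NOT in the tree; for DENSE wide patterns (`K_{d,d}`) (IND₂) is false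
(no induced `P₄`), so as a hypothesis over ALL patterns it only calibrates what the sparse route can reach.  No stub closed; θ₁,
the cruxes and VP ≠ VNP NOT moved. [cite: DawarPagoSeppelt2025, Thm 7.3, Thm 7.9; ChenFlumLiu2025, Thm 11.1, Thm 12.2]
-/

set_option linter.dupNamespace false

noncomputable section

open scoped Classical

namespace Summit.ValiantsHypothesis.ValiantsHypothesis.Theorems.CFIHomMonotone

open MvPolynomial
open Literature.ModelTheory.FiniteModelTheory Literature.ModelTheory.FiniteModelTheory.ChenFlumLiu2025
open Literature.Computability.AlgebraicComplexity
open Summit.ValiantsHypothesis.ValiantsHypothesis.Theorems.MonotoneRestorationQPLinearWidth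

/-- **(IND₂) ⇒ (W1-lin) at every width `k ≥ 1`**: induced wide 2-subdivisions inside every wide pattern give linear-size
`HomIndist` witnesses (the apex witnesses of `CFIHomMonotoneApex`). [cite: ChenFlumLiu2025, Thm 11.1, Thm 12.2] -/
theorem linearWitness_of_inducedSubdivisions (C : ℕ) (g : ℕ → ℕ)
    (hIND : ∀ (k a b : ℕ) (E : Multiset (Fin a × Fin b)), 1 ≤ k →
      (∀ u : Fin a, ∃ x ∈ E, x.1 = u) → (∀ w : Fin b, ∃ x ∈ E, x.2 = w) →
      g k ≤ Literature.Combinatorics.SimpleGraph.treewidth (patternGraph E) →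
      ∃ (v : ℕ) (B : SimpleGraph (Fin v)), B.Connected ∧ 2 ≤ v ∧
        k ≤ Literature.Combinatorics.SimpleGraph.treewidth B ∧ B.edgeSet.Nonempty ∧
        Fintype.card (CFIVertex B) + 2 ≤ C * (a + b + 1) ∧ Nonempty (subdiv B ↪g patternGraph E))
    {k : ℕ} (hk : 1 ≤ k) (a b : ℕ) (E : Multiset (Fin a × Fin b))
    (hrow : ∀ u : Fin a, ∃ x ∈ E, x.1 = u) (hcol : ∀ w : Fin b, ∃ x ∈ E, x.2 = w)
    (htw : g k ≤ Literature.Combinatorics.SimpleGraph.treewidth (patternGraph E)) :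
    ∃ ν : ℕ, ν ≤ C * (a + b + 1) ∧ ∃ z z' : Fin ν × Fin ν → ℂ, HomIndist ν k z z' ∧
      eval z (homPoly E ν ℂ) ≠ eval z' (homPoly E ν ℂ) := by
  obtain ⟨v, B, hconn, h2, htwB, hE, hcard, ⟨ι⟩⟩ := hIND k a b E hk hrow hcol htw
  obtain ⟨ν, z, z', hν, hzz', hne⟩ := exists_homIndist_apexWitness_of_embedding' E hconn h2 hk htwB hE ι
  exact ⟨ν, hν ▸ hcard, z, z', hzz', hne⟩

/-- **THE CAPSTONE: (IND₂)_{C,g} with `g` polynomially bounded ⇒ the `√N` rung** `WidthRung (fun n => Nat.sqrt n / (3C+3))`: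
every matrix-symmetric `VP` family of degree `≤ √n/(3C+3)` that is `PolylogHomDetermined` has square-symmetric circuits of
quasi-polynomial orbit size.  (Kronecker isolation at level `ν = C(2 deg f_N + 1)`, witnesses padded up to `ν`.)
[cite: DawarPagoSeppelt2025, Thm 7.3, Thm 7.9; DawarWilsenach2025, §3.3] -/
theorem widthRung_sqrt_of_inducedSubdivisions (C : ℕ) (g : ℕ → ℕ) (e : ℕ) (hg : ∀ k, g k ≤ (k + 2) ^ e)
    (hIND : ∀ (k a b : ℕ) (E : Multiset (Fin a × Fin b)), 1 ≤ k →
      (∀ u : Fin a, ∃ x ∈ E, x.1 = u) → (∀ w : Fin b, ∃ x ∈ E, x.2 = w) →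
      g k ≤ Literature.Combinatorics.SimpleGraph.treewidth (patternGraph E) →
      ∃ (v : ℕ) (B : SimpleGraph (Fin v)), B.Connected ∧ 2 ≤ v ∧
        k ≤ Literature.Combinatorics.SimpleGraph.treewidth B ∧ B.edgeSet.Nonempty ∧
        Fintype.card (CFIVertex B) + 2 ≤ C * (a + b + 1) ∧ Nonempty (subdiv B ↪g patternGraph E)) :
    WidthRung fun n => Nat.sqrt n / (3 * C + 3) := by
  intro f hsym _hVP hdegle hdet
  obtain ⟨c₀, hc₀⟩ := hdet
  obtain ⟨c', hc'⟩ := SmallWitnessRung.exists_polylog_dominates c₀ e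
  refine ⟨c' + 3, fun N =>
    IsolationAnyLevel.qpOrbit_of_matrixSymmetric_of_smallDistinguishable₂ f c₀ c' hsym hc₀ (fun n => ?_) N⟩
  -- the degree budget: `deg · C(2 deg + 1) ≤ n` from `deg ≤ √n / (3C+3)`
  have hdeg : (f n).totalDegree * (C * (2 * (f n).totalDegree + 1)) ≤ n := by
    have h0 : (f n).totalDegree ≤ Nat.sqrt n / (3 * C + 3) := hdegle n
    set d := (f n).totalDegree with hd
    set s := Nat.sqrt n with hs
    have h1 : (3 * C + 3) * d ≤ s :=
      calc (3 * C + 3) * d ≤ (3 * C + 3) * (s / (3 * C + 3)) := Nat.mul_le_mul_left _ h0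
        _ ≤ s := Nat.mul_div_le s (3 * C + 3)
    have h2 : s * s ≤ n := Nat.sqrt_le n
    have h3 : d ≤ d * d := by
      rcases Nat.eq_zero_or_pos d with h | h
      · simp [h]
      · exact Nat.le_mul_of_pos_left d h
    have h4 : (3 * C + 3) * d * ((3 * C + 3) * d) ≤ s * s := Nat.mul_le_mul h1 h1
    nlinarith [h1, h2, h3, h4]
  -- the widths used are positive
  have hk1 : 1 ≤ (Nat.log 2 n + c₀) ^ c₀ := by
    rcases Nat.eq_zero_or_pos c₀ with h | h
    · simp [h]
    · exact Nat.one_le_pow _ _ (by omega)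
  refine ⟨C * (2 * (f n).totalDegree + 1), hdeg, fun a b E ha hb hrow hcol htw => ?_⟩
  obtain ⟨ν, hν, hwit⟩ := linearWitness_of_inducedSubdivisions C g hIND hk1 a b E hrow hcol
    (le_trans ((hg _).trans (hc' (Nat.log 2 n))) htw)
  have hνle : ν ≤ C * (2 * (f n).totalDegree + 1) := hν.trans (Nat.mul_le_mul_left C (by omega))
  exact exists_homIndist_witness_mono E hrow hcol hνle hwit

end Summit.ValiantsHypothesis.ValiantsHypothesis.Theorems.CFIHomMonotone

end
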